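import Summits.NavierStokesRegularity.NavierStokesRegularity.Theorems.PoloidalWindowDoorPoloidalWindowRigidityZShockRotatingProfileLogPolar
import HarnessLib

/-!
# Crux K2 `PoloidalWindowRigidity` (stmt-NavierStokesRegularity-19708), line `z_shock` — R3 inhabitant census: ROTATING PATTERNS of the
# autonomous thick height-evolution (IV) — the CIRCLE FLUX LAW and the MEAN-VALUE LAW of a rotating pattern

`--supports stmt-NavierStokesRegularity-19708 --as helper` (leafhand-ns-poloidalwindowdoor-3 g9, cell decomp-ns, 2026-08-31).  Class-free,
def-free; Mathlib + parts I/II (`…ZShockRotatingProfile`, `…ZShockRotatingProfileLogPolar`).  **No stub and no summit is closed by this file;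
Navier–Stokes regularity is NOT proved here (rung 0).**

WHY THIS FILE.  Parts I–III typed the rotating-pattern inhabitant candidates `W(s, y) = Ψ(R_{ωs} y)` of the autonomous thick column of
`stub_zShockThickAut` by their profile equation `ω² ΘΘΨ = Σᵢ ∂ᵢ(γ(Ψ)∂ᵢΨ)` and its radius-as-time form `X(γ(Ψ)XΨ) = Θ((ω²|y|² − γ(Ψ))ΘΨ)`
(`XΨ(y) = DΨ(y)[y]`, `ΘΨ(y) = DΨ(y)[Jy]`, `Jy = (−y₁, y₀)`).  The exterior (radius-as-time, angle-periodic) analysis named in the census («rotating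
patterns», evidence #46 ROTATING-ENTRANCE-leafhand-3-g9.md §3, brick F1) starts from the first integral law of that equation on circles — the
«mass» Noether law of the height-evolution read on a rotating pattern.  In polar parametrisation `P r α = (r cos α, r sin α)` (written out, no chart
object), with the radial unit vector `u α = (cos α, sin α)`:

* polar calculus (`hasDerivAt_polar_radius`: `∂_r P = u`; `hasDerivAt_polar_angle`: `∂_α P = J P`; `polar_zero_radius`, `polar_two_pi`, `polar_eq_smul`,
  `polar_apply_zero/one`, `radialUnit_apply`, `norm_polar_le`, `norm_radialUnit_le`, `continuous_polar`, `continuous_radialUnit`);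
* `hasDerivAt_circleIntegral` — DIFFERENTIATION UNDER THE INTEGRAL SIGN on circles: for `φ ∈ C¹(ℝ²)`,
  `d/dr ∫₀^{2π} φ(P r α) dα = ∫₀^{2π} Dφ(P r α)[u α] dα` (dominated derivative, `Dφ` bounded on compact balls);
* `integral_angularDeriv_eq_zero` — for `H ∈ C¹`, `∫₀^{2π} DH(P r α)[J(P r α)] dα = 0` (FTC in the angle + periodicity);
* ★ `circle_radialFlux_eq_zero` — **the circle flux law.**  If the `C²` profile `Ψ` solves the rotating-pattern equation (`γ ∈ C¹`), then for every
  `r > 0`:  `∫₀^{2π} γ(Ψ(P r α)) · DΨ(P r α)[u α] dα = 0` — the radial flux `γ(Ψ)∂_rΨ` has zero mean on EVERY circle about the rotation axis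
  (radius-as-time form integrated over the angle: `r ∂_r ∮ γ(Ψ) XΨ dα = ∮ ∂_α(…) dα = 0`, then `r ↓ 0`);
* ★ `circleMean_potential_eq` — **the mean-value law.**  With `Γ' = γ`: `∫₀^{2π} Γ(Ψ(P r α)) dα = 2π · Γ(Ψ(0))` for every `r ≥ 0` — the circular
  means of the potential `Γ(Ψ)` about the axis are all equal to its value on the axis (so a rotating pattern cannot, e.g., have `Γ(Ψ)` above
  `Γ(Ψ(0))` on a whole circle).

Elementary (chain rule, FTC, dominated differentiation, mean value theorem); no rigidity is proved.  presearch: none needed beyond parts I–II (the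
differentiation-under-the-integral pattern is the tree's `…CondenserCircleMeanDerivative.hasDerivAt_circleAverage_radius`, re-done here in the
`EuclideanSpace ℝ (Fin 2)` typing of the z_shock files). [folklore]
-/

noncomputable section

namespace Summit.NavierStokesRegularity.NavierStokesRegularity.Theorems.PoloidalWindowDoorPoloidalWindowRigidityZShockRotatingProfileFlux

-- the summit and its single sub-problem share the name (CONVENTIONS §1)
set_option linter.dupNamespace false

open Set Filter Topology Function MeasureTheory intervalIntegral
open Summit.NavierStokesRegularity.NavierStokesRegularity.Theorems.PoloidalWindowDoorPoloidalWindowRigidityZShockRotatingProfile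
open Summit.NavierStokesRegularity.NavierStokesRegularity.Theorems.PoloidalWindowDoorPoloidalWindowRigidityZShockRotatingProfileLogPolar

variable {Ψ φ : EuclideanSpace ℝ (Fin 2) → ℝ} {γ Γ : ℝ → ℝ} {ω : ℝ}
  {J : EuclideanSpace ℝ (Fin 2) → EuclideanSpace ℝ (Fin 2)} {P : ℝ → ℝ → EuclideanSpace ℝ (Fin 2)} {u : ℝ → EuclideanSpace ℝ (Fin 2)}

/-! ### Polar calculus -/

/-- `∂_r P(r, α) = u(α)`. [folklore] -/
theorem hasDerivAt_polar_radius
    (hP : ∀ r α, P r α = (r * Real.cos α) • EuclideanSpace.single (0 : Fin 2) (1 : ℝ) + (r * Real.sin α) • EuclideanSpace.single (1 : Fin 2) (1 : ℝ))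
    (hu : ∀ α, u α = Real.cos α • EuclideanSpace.single (0 : Fin 2) (1 : ℝ) + Real.sin α • EuclideanSpace.single (1 : Fin 2) (1 : ℝ))
    (r α : ℝ) : HasDerivAt (fun r' => P r' α) (u α) r := by
  have hfun : (fun r' => P r' α) = fun r' => (r' * Real.cos α) • EuclideanSpace.single (0 : Fin 2) (1 : ℝ) +
      (r' * Real.sin α) • EuclideanSpace.single (1 : Fin 2) (1 : ℝ) := funext fun r' => hP r' α
  rw [hfun, hu]
  have h0 : HasDerivAt (fun r' : ℝ => r' * Real.cos α) (Real.cos α) r := by simpa using (hasDerivAt_id r).mul_const (Real.cos α)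
  have h1 : HasDerivAt (fun r' : ℝ => r' * Real.sin α) (Real.sin α) r := by simpa using (hasDerivAt_id r).mul_const (Real.sin α)
  exact (h0.smul_const _).add (h1.smul_const _)

/-- `∂_α P(r, α) = J(P(r, α))`. [folklore] -/
theorem hasDerivAt_polar_angle
    (hP : ∀ r α, P r α = (r * Real.cos α) • EuclideanSpace.single (0 : Fin 2) (1 : ℝ) + (r * Real.sin α) • EuclideanSpace.single (1 : Fin 2) (1 : ℝ))
    (hJ : ∀ y' : EuclideanSpace ℝ (Fin 2), J y' = (-(y' 1)) • EuclideanSpace.single (0 : Fin 2) (1 : ℝ) +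
      (y' 0) • EuclideanSpace.single (1 : Fin 2) (1 : ℝ))
    (r α : ℝ) : HasDerivAt (fun α' => P r α') (J (P r α)) α := by
  have hfun : (fun α' => P r α') = fun α' => (r * Real.cos α') • EuclideanSpace.single (0 : Fin 2) (1 : ℝ) +
      (r * Real.sin α') • EuclideanSpace.single (1 : Fin 2) (1 : ℝ) := funext fun α' => hP r α'
  rw [hfun, hJ, hP]
  have h0 : HasDerivAt (fun α' : ℝ => r * Real.cos α') (r * -Real.sin α) α := (Real.hasDerivAt_cos α).const_mul r
  have h1 : HasDerivAt (fun α' : ℝ => r * Real.sin α') (r * Real.cos α) α := (Real.hasDerivAt_sin α).const_mul r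
  refine ((h0.smul_const (EuclideanSpace.single (0 : Fin 2) (1 : ℝ))).add
    (h1.smul_const (EuclideanSpace.single (1 : Fin 2) (1 : ℝ)))).congr_deriv ?_
  ext i
  fin_cases i <;> simp

/-- `P(0, α) = 0`. [folklore] -/
theorem polar_zero_radius
    (hP : ∀ r α, P r α = (r * Real.cos α) • EuclideanSpace.single (0 : Fin 2) (1 : ℝ) + (r * Real.sin α) • EuclideanSpace.single (1 : Fin 2) (1 : ℝ))
    (α : ℝ) : P 0 α = 0 := by
  rw [hP]; simp

/-- `P(r, 2π) = P(r, 0)`. [folklore] -/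
theorem polar_two_pi
    (hP : ∀ r α, P r α = (r * Real.cos α) • EuclideanSpace.single (0 : Fin 2) (1 : ℝ) + (r * Real.sin α) • EuclideanSpace.single (1 : Fin 2) (1 : ℝ))
    (r : ℝ) : P r (2 * Real.pi) = P r 0 := by
  rw [hP, hP, Real.cos_two_pi, Real.sin_two_pi, Real.cos_zero, Real.sin_zero]

/-- `P(r, α) = r • u(α)`. [folklore] -/
theorem polar_eq_smul
    (hP : ∀ r α, P r α = (r * Real.cos α) • EuclideanSpace.single (0 : Fin 2) (1 : ℝ) + (r * Real.sin α) • EuclideanSpace.single (1 : Fin 2) (1 : ℝ))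
    (hu : ∀ α, u α = Real.cos α • EuclideanSpace.single (0 : Fin 2) (1 : ℝ) + Real.sin α • EuclideanSpace.single (1 : Fin 2) (1 : ℝ))
    (r α : ℝ) : P r α = r • u α := by
  rw [hP, hu, smul_add, smul_smul, smul_smul]

/-- Coordinates of the polar point. [folklore] -/
theorem polar_apply_zero
    (hP : ∀ r α, P r α = (r * Real.cos α) • EuclideanSpace.single (0 : Fin 2) (1 : ℝ) + (r * Real.sin α) • EuclideanSpace.single (1 : Fin 2) (1 : ℝ))
    (r α : ℝ) : P r α 0 = r * Real.cos α := by
  rw [hP]; simp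

/-- Coordinates of the polar point. [folklore] -/
theorem polar_apply_one
    (hP : ∀ r α, P r α = (r * Real.cos α) • EuclideanSpace.single (0 : Fin 2) (1 : ℝ) + (r * Real.sin α) • EuclideanSpace.single (1 : Fin 2) (1 : ℝ))
    (r α : ℝ) : P r α 1 = r * Real.sin α := by
  rw [hP]; simp

/-- Coordinates of the radial unit vector. [folklore] -/
theorem radialUnit_apply
    (hu : ∀ α, u α = Real.cos α • EuclideanSpace.single (0 : Fin 2) (1 : ℝ) + Real.sin α • EuclideanSpace.single (1 : Fin 2) (1 : ℝ))
    (α : ℝ) : u α 0 = Real.cos α ∧ u α 1 = Real.sin α := by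
  rw [hu]; constructor <;> simp

/-- `|P(r, α)| ≤ |r|` (in fact equality). [folklore] -/
theorem norm_polar_le
    (hP : ∀ r α, P r α = (r * Real.cos α) • EuclideanSpace.single (0 : Fin 2) (1 : ℝ) + (r * Real.sin α) • EuclideanSpace.single (1 : Fin 2) (1 : ℝ))
    (r α : ℝ) : ‖P r α‖ ≤ |r| := by
  have hcs := Real.cos_sq_add_sin_sq α
  have hsq : ‖P r α‖ ^ 2 = r ^ 2 := by
    rw [EuclideanSpace.norm_eq, Real.sq_sqrt (Finset.sum_nonneg fun i _ => sq_nonneg _), Fin.sum_univ_two, Real.norm_eq_abs,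
      Real.norm_eq_abs, sq_abs, sq_abs, polar_apply_zero hP, polar_apply_one hP]
    linear_combination r ^ 2 * hcs
  have h : ‖P r α‖ = |r| := by
    rw [← Real.sqrt_sq (norm_nonneg (P r α)), hsq, Real.sqrt_sq_eq_abs]
  exact h.le

/-- `|u(α)| ≤ 1` (in fact equality). [folklore] -/
theorem norm_radialUnit_le
    (hu : ∀ α, u α = Real.cos α • EuclideanSpace.single (0 : Fin 2) (1 : ℝ) + Real.sin α • EuclideanSpace.single (1 : Fin 2) (1 : ℝ))
    (α : ℝ) : ‖u α‖ ≤ 1 := by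
  have hcs := Real.cos_sq_add_sin_sq α
  have hsq : ‖u α‖ ^ 2 = 1 := by
    rw [EuclideanSpace.norm_eq, Real.sq_sqrt (Finset.sum_nonneg fun i _ => sq_nonneg _), Fin.sum_univ_two, Real.norm_eq_abs,
      Real.norm_eq_abs, sq_abs, sq_abs, (radialUnit_apply hu α).1, (radialUnit_apply hu α).2, hcs]
  nlinarith [norm_nonneg (u α)]

/-- The polar parametrisation is jointly continuous. [folklore] -/
theorem continuous_polar
    (hP : ∀ r α, P r α = (r * Real.cos α) • EuclideanSpace.single (0 : Fin 2) (1 : ℝ) + (r * Real.sin α) • EuclideanSpace.single (1 : Fin 2) (1 : ℝ)) :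
    Continuous fun p : ℝ × ℝ => P p.1 p.2 := by
  have hfun : (fun p : ℝ × ℝ => P p.1 p.2) = fun p => (p.1 * Real.cos p.2) • EuclideanSpace.single (0 : Fin 2) (1 : ℝ) +
      (p.1 * Real.sin p.2) • EuclideanSpace.single (1 : Fin 2) (1 : ℝ) := funext fun p => hP p.1 p.2
  rw [hfun]
  fun_prop

/-- The radial unit vector is continuous in the angle. [folklore] -/
theorem continuous_radialUnit
    (hu : ∀ α, u α = Real.cos α • EuclideanSpace.single (0 : Fin 2) (1 : ℝ) + Real.sin α • EuclideanSpace.single (1 : Fin 2) (1 : ℝ)) :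
    Continuous u := by
  have hfun : u = fun α => Real.cos α • EuclideanSpace.single (0 : Fin 2) (1 : ℝ) + Real.sin α • EuclideanSpace.single (1 : Fin 2) (1 : ℝ) :=
    funext hu
  rw [hfun]
  fun_prop

/-! ### Differentiation under the integral sign on circles -/

/-- **Radial derivative of a circle integral.**  For `φ ∈ C¹(ℝ²)` and every `r₀`,
`d/dr|_{r₀} ∫₀^{2π} φ(P r α) dα = ∫₀^{2π} Dφ(P r₀ α)[u α] dα` (dominated differentiation: `Dφ` is bounded on the ball of radius `|r₀| + 1`).
[folklore] -/
theorem hasDerivAt_circleIntegral (hφ : ContDiff ℝ 1 φ)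
    (hP : ∀ r α, P r α = (r * Real.cos α) • EuclideanSpace.single (0 : Fin 2) (1 : ℝ) + (r * Real.sin α) • EuclideanSpace.single (1 : Fin 2) (1 : ℝ))
    (hu : ∀ α, u α = Real.cos α • EuclideanSpace.single (0 : Fin 2) (1 : ℝ) + Real.sin α • EuclideanSpace.single (1 : Fin 2) (1 : ℝ))
    (r₀ : ℝ) :
    HasDerivAt (fun r => ∫ α in (0 : ℝ)..2 * Real.pi, φ (P r α)) (∫ α in (0 : ℝ)..2 * Real.pi, fderiv ℝ φ (P r₀ α) (u α)) r₀ := by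
  have hφd : Differentiable ℝ φ := hφ.differentiable one_ne_zero
  have hφc : Continuous φ := hφ.continuous
  have hDc : Continuous (fderiv ℝ φ) := hφ.continuous_fderiv one_ne_zero
  have hPc := continuous_polar hP
  have huc := continuous_radialUnit hu
  have hPr : ∀ r, Continuous fun α => P r α := fun r => hPc.comp (continuous_const.prodMk continuous_id)
  have hI : Continuous fun α => fderiv ℝ φ (P r₀ α) (u α) := (hDc.comp (hPr r₀)).clm_apply huc
  -- a uniform bound for `‖Dφ‖` on the closed ball of radius `|r₀| + 1`
  obtain ⟨M, hM⟩ := (isCompact_closedBall (0 : EuclideanSpace ℝ (Fin 2)) (|r₀| + 1)).exists_bound_of_continuousOn hDc.continuousOn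
  have key := intervalIntegral.hasDerivAt_integral_of_dominated_loc_of_deriv_le
    (μ := volume) (a := 0) (b := 2 * Real.pi) (x₀ := r₀) (bound := fun _ => M)
    (F := fun r α => φ (P r α)) (F' := fun r α => fderiv ℝ φ (P r α) (u α))
    (Metric.ball_mem_nhds r₀ zero_lt_one)
    (Eventually.of_forall fun r => (hφc.comp (hPr r)).aestronglyMeasurable)
    ((hφc.comp (hPr r₀)).intervalIntegrable _ _)
    hI.aestronglyMeasurable
    (Eventually.of_forall fun α _ r hr => by
      have hr' : ‖P r α‖ ≤ |r₀| + 1 := by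
        have : |r - r₀| < 1 := by rw [← Real.dist_eq]; exact hr
        have h2 := abs_sub_abs_le_abs_sub r r₀
        linarith [norm_polar_le hP r α]
      calc ‖fderiv ℝ φ (P r α) (u α)‖
          ≤ ‖fderiv ℝ φ (P r α)‖ * ‖u α‖ := ContinuousLinearMap.le_opNorm _ _
        _ ≤ ‖fderiv ℝ φ (P r α)‖ * 1 := by gcongr; exact norm_radialUnit_le hu α
        _ ≤ M := by rw [mul_one]; exact hM _ (Metric.mem_closedBall.2 (by simpa using hr')))
    intervalIntegrable_const
    (Eventually.of_forall fun α _ r _ => (hφd (P r α)).hasFDerivAt.comp_hasDerivAt r (hasDerivAt_polar_radius hP hu r α))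
  exact key.2

/-- **An angular derivative integrates to zero over a circle.**  For `H ∈ C¹(ℝ²)` and every `r`,
`∫₀^{2π} DH(P r α)[J(P r α)] dα = H(P r 2π) − H(P r 0) = 0`. [folklore] -/
theorem integral_angularDeriv_eq_zero {H : EuclideanSpace ℝ (Fin 2) → ℝ} (hH : ContDiff ℝ 1 H)
    (hP : ∀ r α, P r α = (r * Real.cos α) • EuclideanSpace.single (0 : Fin 2) (1 : ℝ) + (r * Real.sin α) • EuclideanSpace.single (1 : Fin 2) (1 : ℝ))
    (hJ : ∀ y' : EuclideanSpace ℝ (Fin 2), J y' = (-(y' 1)) • EuclideanSpace.single (0 : Fin 2) (1 : ℝ) +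
      (y' 0) • EuclideanSpace.single (1 : Fin 2) (1 : ℝ))
    (r : ℝ) : ∫ α in (0 : ℝ)..2 * Real.pi, fderiv ℝ H (P r α) (J (P r α)) = 0 := by
  have hHd : Differentiable ℝ H := hH.differentiable one_ne_zero
  have hJ' : J = fun y' => (-(y' 1)) • EuclideanSpace.single (0 : Fin 2) (1 : ℝ) +
      (y' 0) • EuclideanSpace.single (1 : Fin 2) (1 : ℝ) := funext hJ
  have hJc : Continuous J := by rw [hJ']; fun_prop
  have hPr : Continuous fun α => P r α := (continuous_polar hP).comp (continuous_const.prodMk continuous_id)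
  have hd : ∀ α ∈ uIcc (0 : ℝ) (2 * Real.pi), HasDerivAt (fun α' => H (P r α')) (fderiv ℝ H (P r α) (J (P r α))) α :=
    fun α _ => (hHd (P r α)).hasFDerivAt.comp_hasDerivAt α (hasDerivAt_polar_angle hP hJ r α)
  have hint : IntervalIntegrable (fun α => fderiv ℝ H (P r α) (J (P r α))) volume (0 : ℝ) (2 * Real.pi) :=
    (((hH.continuous_fderiv one_ne_zero).comp hPr).clm_apply (hJc.comp hPr)).intervalIntegrable _ _
  rw [integral_eq_sub_of_hasDerivAt hd hint, polar_two_pi hP, sub_self]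

/-! ### The circle flux law -/

/-- ★ **The circle flux law of a rotating pattern.**  Let the `C²` profile `Ψ` solve the rotating-pattern equation
`ω² ΘΘΨ = Σᵢ ∂ᵢ(γ(Ψ)∂ᵢΨ)` (`γ ∈ C¹`).  Then on every circle about the rotation axis the radial flux has zero mean:
`∫₀^{2π} γ(Ψ(P r α)) · DΨ(P r α)[u α] dα = 0` for every `r > 0`.  Proof: with `G = γ(Ψ)·XΨ` and `H = (ω²|·|² − γ(Ψ))·ΘΨ` the radius-as-time
form (`rotating_profile_equation_logpolar`) reads `DG(x)[x] = DH(x)[Jx]`; on the circle of radius `r` this is `r·DG(P)[u] = ∂_α[H∘P]`, whose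
integral vanishes; so `Φ(r) = ∫₀^{2π} G(P r α) dα` has `Φ' = 0` on `r > 0` (`hasDerivAt_circleIntegral`), and `Φ(0) = 0`; finally `G(P r α) =
r·γ(Ψ)DΨ(P)[u]`. [folklore] -/
theorem circle_radialFlux_eq_zero (hΨ : ContDiff ℝ 2 Ψ) (hγ : ContDiff ℝ 1 γ)
    (hJ : ∀ y' : EuclideanSpace ℝ (Fin 2), J y' = (-(y' 1)) • EuclideanSpace.single (0 : Fin 2) (1 : ℝ) +
      (y' 0) • EuclideanSpace.single (1 : Fin 2) (1 : ℝ))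
    (hP : ∀ r α, P r α = (r * Real.cos α) • EuclideanSpace.single (0 : Fin 2) (1 : ℝ) + (r * Real.sin α) • EuclideanSpace.single (1 : Fin 2) (1 : ℝ))
    (hu : ∀ α, u α = Real.cos α • EuclideanSpace.single (0 : Fin 2) (1 : ℝ) + Real.sin α • EuclideanSpace.single (1 : Fin 2) (1 : ℝ))
    (hrot : ∀ y : EuclideanSpace ℝ (Fin 2),
      ω ^ 2 * fderiv ℝ (fun y' => fderiv ℝ Ψ y' (J y')) y (J y) =
        ∑ i, fderiv ℝ (fun y' => γ (Ψ y') * fderiv ℝ Ψ y' (EuclideanSpace.single i 1)) y (EuclideanSpace.single i 1))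
    {r : ℝ} (hr : 0 < r) :
    ∫ α in (0 : ℝ)..2 * Real.pi, γ (Ψ (P r α)) * fderiv ℝ Ψ (P r α) (u α) = 0 := by
  -- regularity of `G = γ(Ψ)·XΨ` and `H = (ω²|·|² − γ(Ψ))·ΘΨ`
  have hJ' : J = fun y' => (-(y' 1)) • EuclideanSpace.single (0 : Fin 2) (1 : ℝ) +
      (y' 0) • EuclideanSpace.single (1 : Fin 2) (1 : ℝ) := funext hJ
  have hJc : ContDiff ℝ 1 J := by rw [hJ']; fun_prop
  have hΨ1 : ContDiff ℝ 1 Ψ := hΨ.of_le one_le_two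
  have hDΨ : ContDiff ℝ 1 (fderiv ℝ Ψ) := hΨ.fderiv_right (m := 1) le_rfl
  have hγΨ : ContDiff ℝ 1 fun y' => γ (Ψ y') := hγ.comp hΨ1
  have hG : ContDiff ℝ 1 fun x' => γ (Ψ x') * fderiv ℝ Ψ x' x' := hγΨ.mul (hDΨ.clm_apply contDiff_id)
  have hH : ContDiff ℝ 1 fun x' => (ω ^ 2 * ‖x'‖ ^ 2 - γ (Ψ x')) * fderiv ℝ Ψ x' (J x') :=
    ((contDiff_const.mul (contDiff_norm_sq ℝ (n := 1))).sub hγΨ).mul (hDΨ.clm_apply hJc)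
  -- `Φ(r') = ∫ G(P r' α) dα` has zero derivative at every `r' ≠ 0`
  have hΦd : ∀ r', HasDerivAt (fun r'' => ∫ α in (0 : ℝ)..2 * Real.pi, γ (Ψ (P r'' α)) * fderiv ℝ Ψ (P r'' α) (P r'' α))
      (∫ α in (0 : ℝ)..2 * Real.pi, fderiv ℝ (fun x' => γ (Ψ x') * fderiv ℝ Ψ x' x') (P r' α) (u α)) r' :=
    fun r' => hasDerivAt_circleIntegral hG hP hu r'
  have hzero : ∀ r', r' ≠ 0 →
      ∫ α in (0 : ℝ)..2 * Real.pi, fderiv ℝ (fun x' => γ (Ψ x') * fderiv ℝ Ψ x' x') (P r' α) (u α) = 0 := by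
    intro r' hr'
    have h1 : ∫ α in (0 : ℝ)..2 * Real.pi, fderiv ℝ (fun x' => γ (Ψ x') * fderiv ℝ Ψ x' x') (P r' α) (P r' α) = 0 := by
      have hfun : (fun α => fderiv ℝ (fun x' => γ (Ψ x') * fderiv ℝ Ψ x' x') (P r' α) (P r' α)) =
          fun α => fderiv ℝ (fun x' => (ω ^ 2 * ‖x'‖ ^ 2 - γ (Ψ x')) * fderiv ℝ Ψ x' (J x')) (P r' α) (J (P r' α)) :=
        funext fun α => rotating_profile_equation_logpolar hΨ hγ hJ hrot (P r' α)
      rw [hfun]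
      exact integral_angularDeriv_eq_zero hH hP hJ r'
    have h2 : (fun α => fderiv ℝ (fun x' => γ (Ψ x') * fderiv ℝ Ψ x' x') (P r' α) (P r' α)) =
        fun α => r' * fderiv ℝ (fun x' => γ (Ψ x') * fderiv ℝ Ψ x' x') (P r' α) (u α) := by
      funext α; rw [polar_eq_smul hP hu r' α, map_smul, smul_eq_mul, ← polar_eq_smul hP hu r' α]
    rw [h2, intervalIntegral.integral_const_mul] at h1
    rcases mul_eq_zero.1 h1 with h | h
    · exact absurd h hr'
    · exact h
  -- mean value theorem on `[0, r]`: `Φ(r) = Φ(0) = 0`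
  obtain ⟨ξ, hξ, hslope⟩ := exists_hasDerivAt_eq_slope
    (fun r'' => ∫ α in (0 : ℝ)..2 * Real.pi, γ (Ψ (P r'' α)) * fderiv ℝ Ψ (P r'' α) (P r'' α)) _ hr
    (fun r' _ => (hΦd r').continuousAt.continuousWithinAt) (fun r' _ => hΦd r')
  rw [hzero ξ hξ.1.ne'] at hslope
  have hΦ0 : ∫ α in (0 : ℝ)..2 * Real.pi, γ (Ψ (P 0 α)) * fderiv ℝ Ψ (P 0 α) (P 0 α) = 0 := by
    simp [polar_zero_radius hP]
  have hΦr : ∫ α in (0 : ℝ)..2 * Real.pi, γ (Ψ (P r α)) * fderiv ℝ Ψ (P r α) (P r α) = 0 := by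
    have h := hslope.symm
    rw [div_eq_zero_iff] at h
    rcases h with h | h
    · rwa [hΦ0, sub_zero] at h
    · exact absurd h (by linarith)
  -- `G(P r α) = r · γ(Ψ) DΨ(P)[u]`
  have h3 : (fun α => γ (Ψ (P r α)) * fderiv ℝ Ψ (P r α) (P r α)) = fun α => r * (γ (Ψ (P r α)) * fderiv ℝ Ψ (P r α) (u α)) := by
    funext α; rw [polar_eq_smul hP hu r α, map_smul, smul_eq_mul, ← polar_eq_smul hP hu r α]; ring
  rw [h3, intervalIntegral.integral_const_mul] at hΦr
  rcases mul_eq_zero.1 hΦr with h | h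
  · exact absurd h hr.ne'
  · exact h

/-! ### The mean-value law -/

/-- ★ **The mean-value law of a rotating pattern.**  Under the hypotheses of `circle_radialFlux_eq_zero`, with `Γ` a primitive of `γ`
(`Γ' = γ`): `∫₀^{2π} Γ(Ψ(P r α)) dα = 2π · Γ(Ψ(0))` for every `r ≥ 0` — the circular means of the potential `Γ(Ψ)` about the rotation axis all
equal its value on the axis.  (`d/dr ∫ Γ(Ψ∘P) dα = ∫ γ(Ψ)DΨ(P)[u] dα = 0` by the flux law; mean value theorem on `[0, r]`.) [folklore] -/
theorem circleMean_potential_eq (hΨ : ContDiff ℝ 2 Ψ) (hγ : ContDiff ℝ 1 γ) (hΓ : ∀ v, HasDerivAt Γ (γ v) v)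
    (hJ : ∀ y' : EuclideanSpace ℝ (Fin 2), J y' = (-(y' 1)) • EuclideanSpace.single (0 : Fin 2) (1 : ℝ) +
      (y' 0) • EuclideanSpace.single (1 : Fin 2) (1 : ℝ))
    (hP : ∀ r α, P r α = (r * Real.cos α) • EuclideanSpace.single (0 : Fin 2) (1 : ℝ) + (r * Real.sin α) • EuclideanSpace.single (1 : Fin 2) (1 : ℝ))
    (hu : ∀ α, u α = Real.cos α • EuclideanSpace.single (0 : Fin 2) (1 : ℝ) + Real.sin α • EuclideanSpace.single (1 : Fin 2) (1 : ℝ))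
    (hrot : ∀ y : EuclideanSpace ℝ (Fin 2),
      ω ^ 2 * fderiv ℝ (fun y' => fderiv ℝ Ψ y' (J y')) y (J y) =
        ∑ i, fderiv ℝ (fun y' => γ (Ψ y') * fderiv ℝ Ψ y' (EuclideanSpace.single i 1)) y (EuclideanSpace.single i 1))
    {r : ℝ} (hr : 0 ≤ r) :
    ∫ α in (0 : ℝ)..2 * Real.pi, Γ (Ψ (P r α)) = 2 * Real.pi * Γ (Ψ 0) := by
  have hΨd : Differentiable ℝ Ψ := hΨ.differentiable two_ne_zero
  have hΨ1 : ContDiff ℝ 1 Ψ := hΨ.of_le one_le_two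
  have hγc : Continuous γ := hγ.continuous
  have hΓ1 : ContDiff ℝ 1 Γ := by
    have hdΓ : deriv Γ = γ := funext fun v => (hΓ v).deriv
    exact contDiff_one_iff_deriv.2 ⟨fun v => (hΓ v).differentiableAt, by rw [hdΓ]; exact hγc⟩
  have hΓΨ : ContDiff ℝ 1 fun x' => Γ (Ψ x') := hΓ1.comp hΨ1
  -- the derivative of `Γ ∘ Ψ` along `u α`
  have hderiv : ∀ x h : EuclideanSpace ℝ (Fin 2), fderiv ℝ (fun x' => Γ (Ψ x')) x h = γ (Ψ x) * fderiv ℝ Ψ x h := by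
    intro x h
    have hc : HasFDerivAt (fun x' => Γ (Ψ x')) (γ (Ψ x) • fderiv ℝ Ψ x) x := (hΓ (Ψ x)).comp_hasFDerivAt x (hΨd x).hasFDerivAt
    rw [hc.fderiv, smul_apply, smul_eq_mul]
  have hmd : ∀ r', HasDerivAt (fun r'' => ∫ α in (0 : ℝ)..2 * Real.pi, Γ (Ψ (P r'' α)))
      (∫ α in (0 : ℝ)..2 * Real.pi, γ (Ψ (P r' α)) * fderiv ℝ Ψ (P r' α) (u α)) r' := by
    intro r'
    have h := hasDerivAt_circleIntegral hΓΨ hP hu r'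
    simp only [hderiv] at h
    exact h
  rcases hr.eq_or_lt with h0 | hpos
  · rw [← h0]
    simp [polar_zero_radius hP]
  obtain ⟨ξ, hξ, hslope⟩ := exists_hasDerivAt_eq_slope (fun r'' => ∫ α in (0 : ℝ)..2 * Real.pi, Γ (Ψ (P r'' α))) _ hpos
    (fun r' _ => (hmd r').continuousAt.continuousWithinAt) (fun r' _ => hmd r')
  rw [circle_radialFlux_eq_zero hΨ hγ hJ hP hu hrot hξ.1] at hslope
  have h0 : ∫ α in (0 : ℝ)..2 * Real.pi, Γ (Ψ (P 0 α)) = 2 * Real.pi * Γ (Ψ 0) := by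
    simp [polar_zero_radius hP]
  have h := hslope.symm
  rw [div_eq_zero_iff] at h
  rcases h with h | h
  · rw [h0] at h; linarith
  · exact absurd h (by linarith)

end Summit.NavierStokesRegularity.NavierStokesRegularity.Theorems.PoloidalWindowDoorPoloidalWindowRigidityZShockRotatingProfileFlux
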